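import Literature.AnabelianGeometry.SemiGraphs.TemperedAbsolutenessLawsNonVacuity
import HarnessLib

/-!
# [SemiAnbd] Cor. 6.10 / 6.11 (F-1656 / F-1655): the NAMED-LEAF hypothesis bundle of
# `temperedAbsolutenessHolds_of_leaves` / `genusZeroTempAbsolutenessHolds_of_leaves` is JOINTLY SATISFIABLE
# at a certificate certifying a cusped datum

Mochizuki, *Semi-graphs of anabelioids*, Publ. RIMS **42** (2006) [SemiAnbd], Cor. 6.10 / Cor. 6.11 p. 77,
over [Mzk8] Thm. 1.3 p. 6 and §4 pp. 33–34. [cite: MochizukiSemiAnbd2006, Cor 6.10 p.77]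

PROOF-ONLY companion (abc-iut cell, D-0079 L-F pack D, seat abc-iut-f-168 gen 5; no `def`, no `instance`) of
`TemperedAbsolutenessLeafReduction.lean` (this seat, same day), which re-bases the gen-0 conditional closers
of F-1656 / F-1655 (p433627) on the leaves `h66` (F-1707), `h65` (F-1704), `h13i` / `h13ii` ([Mzk8] Thm. 1.3
(i)/(ii) at `Π_{X_K}`, abc-iut-f-174's binder shapes), `hDc` (compact decomposition groups, GAP row
G-L5t11g4-1), `hgood` (Kummer-transport functoriality), `hsub` / `hstab` ([Mzk8] §4 structure laws: members
closed in `D_y`; `D_y`-conjugation stability) and, for Cor. 6.11, `hCor411` ([Mzk8] Cor. 4.11, absolute).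
A conditional closer with an unsatisfiable antecedent would be worthless; this file exhibits — WITHOUT importing
the closer file, so that it stands on the frozen interfaces alone — a certificate at which ALL TEN leaves hold:

* `AbsolutenessOrigin.exists_cusped_certificate_leaves` — the certificate of this seat's gen-2 file
  (`exists_cusped_certificate_laws`, p441779: the punctured-disc datum `Π^temp = G_{ℚ_p} × Ẑ`, compact, one
  `K`-rational cusp, `D_x = Π^temp`, `I_x = Z(Π^temp)`; canonical structures := ALL splittings; Kummer datum
  `H¹ = ℤ` with unit image `2ℤ`; every transport certified) ALSO satisfies the five NEW leaves: `h13i` (one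
  closed point), `h13ii` (`ι(D_x) = Π̂` is its own commensurator), `hDc` (compactness), `hsub` (splittings are
  closed subgroups of `D_x = Π^temp`), `hstab` (at disc type the splittings are the centre-splittings, a
  conjugation-stable family — `image_conjAct_smul_centerSplittings_eq`).

HONEST LIMITS as in the gen-2 file: a toy (abelian `Δ^temp`, abstract Kummer records, one point);
binder-satisfiability evidence, not a model of a hyperbolic curve and not an endorsement; the `∀Ω` closures of
F-1655 / F-1656 remain refuted (p431240); nothing printed is asserted; no side taken on [IUTchIII] Cor. 3.12.
-/

noncomputable section

namespace Literature.AnabelianGeometry.SemiGraphs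

open scoped Pointwise

/-- Every additive automorphism of `ℤ` (namely `± id`) carries every subgroup onto itself (local copy of the
gen-2 file's private lemma). [folklore] -/
private theorem addSubgroup_map_int_addEquiv_leaf (ψ : ℤ ≃+ ℤ) (U : AddSubgroup ℤ) :
    U.map ψ.toAddMonoidHom = U := by
  have hx : ∀ x : ℤ, ψ x = x * ψ 1 := fun x => by
    conv_lhs => rw [← mul_one x, ← smul_eq_mul]
    rw [map_zsmul, smul_eq_mul]
  have hu : ψ 1 = 1 ∨ ψ 1 = -1 := by
    refine Int.eq_one_or_neg_one_of_mul_eq_one (v := ψ.symm 1) ?_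
    have h := ψ.apply_symm_apply 1
    rw [hx] at h
    rwa [mul_comm] at h
  ext y
  simp only [AddSubgroup.mem_map, AddEquiv.coe_toAddMonoidHom]
  constructor
  · rintro ⟨x, hxU, rfl⟩
    rw [hx]
    rcases hu with h | h
    · rw [h, mul_one]; exact hxU
    · rw [h, mul_neg_one]; exact U.neg_mem hxU
  · intro hy
    rcases hu with h | h
    · exact ⟨y, hy, by rw [hx, h, mul_one]⟩
    · exact ⟨-y, U.neg_mem hy, by rw [hx, h, mul_neg_one, neg_neg]⟩

variable {p : ℕ} [Fact p.Prime]

namespace TemperedCurve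

/-- At a cusp of punctured-disc type (`D_x = Π^temp`, `I_x = Z(Π^temp)`) the [Mzk8] §4 splittings are exactly
the centre-splittings of `Π^temp`. [cite: MochizukiSemiAnbd2006, §6 p.77] -/
theorem setOf_isSplittingSubgroup_of_disc (X : TemperedCurve p) {x : X.Pt} (hD : X.decomp x = ⊤)
    (hI : X.inertia x = Subgroup.center X.PiTemp) :
    {S | X.IsSplittingSubgroup x S} =
      {S : Subgroup X.PiTemp | IsClosed (S : Set X.PiTemp) ∧ S ⊓ Subgroup.center X.PiTemp = ⊥ ∧
        S ⊔ Subgroup.center X.PiTemp = ⊤} := by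
  ext S
  change IsClosed (S : Set X.PiTemp) ∧ S ≤ X.decomp x ∧ S ⊓ X.inertia x = ⊥ ∧
      S ⊔ X.inertia x = X.decomp x ↔ _
  rw [hD, hI]
  exact ⟨fun h => ⟨h.1, h.2.2.1, h.2.2.2⟩, fun h => ⟨h.1, le_top, h.2.1, h.2.2⟩⟩

/-- The whole group is its own commensurator. [folklore] -/
private theorem commensurator_top {G : Type*} [Group G] :
    Subgroup.Commensurable.commensurator (⊤ : Subgroup G) = ⊤ := by
  refine top_unique fun g _ => ?_
  rw [Subgroup.Commensurable.commensurator_mem_iff]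
  have h : ConjAct.toConjAct g • (⊤ : Subgroup G) = ⊤ :=
    top_unique fun x _ => by
      rw [Subgroup.mem_pointwise_smul_iff_inv_smul_mem]
      exact Subgroup.mem_top _
  rw [h]

end TemperedCurve

namespace AbsolutenessOrigin

/-- **NON-VACUITY OF THE NAMED-LEAF BUNDLE OF THE COR. 6.10 / 6.11 CLOSERS AT A CUSPED CERTIFICATE.**  There are
an `AbsolutenessOrigin` certificate `Ω`, a §6 datum `X` (punctured-disc type) with a `K`-RATIONAL CUSP,
canonical structures `S` (all splittings), a Kummer datum `k` (`H¹ := ℤ`, unit image `2ℤ ≠ ⊤`) and flags `a`,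
ALL CERTIFIED by `Ω` (which certifies every transport record), at which ALL TEN leaves `h66`, `h65`, `h13i`,
`h13ii`, `hDc`, `hgood`, `hsub`, `hstab`, `hCor411` of `temperedAbsolutenessHolds_of_leaves` /
`genusZeroTempAbsolutenessHolds_of_leaves` hold — stated verbatim in those binder shapes.  Toy datum;
binder-satisfiability evidence only. [cite: MochizukiSemiAnbd2006, Cor 6.10 p.77] -/
theorem exists_cusped_certificate_leaves (p : ℕ) [Fact p.Prime] :
    ∃ (Ω : AbsolutenessOrigin p) (X : TemperedCurve p) (S : CuspidalStructures X) (k : KummerUnitData X)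
      (a : TemperedCurve.CurveArithmeticFlags X),
      Ω.IsHyperbolicCurveOrigin X ∧ Ω.IsStructuresOrigin S ∧ Ω.IsKummerOrigin k ∧ Ω.IsFlagsOrigin a ∧
      (∃ x : X.Pt, X.IsCusp x ∧ X.IsRationalPt x) ∧ S.HasStableReduction ∧
      (∀ x, (S.canonicalIntegral x).Nonempty) ∧ k.unitImage ≠ ⊤ ∧
      (∀ (Y : TemperedCurve p) (kY : KummerUnitData Y) (t : KummerTransport k kY),
        Ω.IsKummerTransportOrigin t) ∧
      -- h66, h65
      Ω.toTemperedOrigin.ProfiniteOuterIsoLiftsHolds ∧ Ω.toTemperedOrigin.CuspidalAbsolutenessHolds ∧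
      -- h13i ([Mzk8] Thm 1.3 (i) at Π̂, f-174's shape)
      (∀ Y : TemperedCurve p, Ω.IsHyperbolicCurveOrigin Y → ∀ x x' : Y.Pt,
        (∃ γ : ConjAct Y.PiHat,
          (Y.decomp x').map Y.toHat.toMonoidHom = γ • (Y.decomp x).map Y.toHat.toMonoidHom) → x' = x) ∧
      -- h13ii ([Mzk8] Thm 1.3 (ii) at Π̂, f-174's shape)
      (∀ Y : TemperedCurve p, Ω.IsHyperbolicCurveOrigin Y → ∀ x : Y.Pt,
        Subgroup.Commensurable.commensurator ((Y.decomp x).map Y.toHat.toMonoidHom) =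
          (Y.decomp x).map Y.toHat.toMonoidHom) ∧
      -- hDc (G-L5t11g4-1)
      (∀ Y : TemperedCurve p, Ω.IsHyperbolicCurveOrigin Y → ∀ y : Y.Pt,
        IsCompact (Y.decomp y : Set Y.PiTemp)) ∧
      -- hgood
      (∀ (X : TemperedCurve p) (kX : KummerUnitData X), Ω.IsHyperbolicCurveOrigin X →
        Ω.IsKummerOrigin kX → ∀ (Y : TemperedCurve p) (kY : KummerUnitData Y) (t : KummerTransport kX kY),
        Ω.IsHyperbolicCurveOrigin Y → Ω.IsKummerOrigin kY → Ω.IsKummerTransportOrigin t →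
        ∀ (αhat : X.PiHat ≃ₜ* Y.PiHat) (β : X.PiTemp ≃ₜ* Y.PiTemp), TemperedCurve.LiesUnder X Y αhat β →
          (kX.unitImage).map (t.h1OfHat αhat).toAddMonoidHom =
            (kX.unitImage).map (t.h1OfTemp β).toAddMonoidHom) ∧
      -- hsub
      (∀ (Y : TemperedCurve p) (SY : CuspidalStructures Y), Ω.IsHyperbolicCurveOrigin Y →
        Ω.IsStructuresOrigin SY → ∀ y : Y.Pt, Y.IsCusp y → ∀ T ∈ SY.canonicalDiscrete y,
          IsClosed (T : Set Y.PiTemp) ∧ T ≤ Y.decomp y) ∧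
      -- hstab
      (∀ (Y : TemperedCurve p) (SY : CuspidalStructures Y), Ω.IsHyperbolicCurveOrigin Y →
        Ω.IsStructuresOrigin SY → ∀ y : Y.Pt, Y.IsCusp y → ∀ t ∈ Y.decomp y,
          (∀ T ∈ SY.canonicalDiscrete y, ConjAct.toConjAct t • T ∈ SY.canonicalDiscrete y) ∧
            ∀ T ∈ SY.canonicalIntegral y, ConjAct.toConjAct t • T ∈ SY.canonicalIntegral y) ∧
      -- hCor411 ([Mzk8] Cor. 4.11, absolute form; Cor. 6.11 only)
      (∀ (X : TemperedCurve p) (SX : CuspidalStructures X) (kX : KummerUnitData X)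
        (aX : TemperedCurve.CurveArithmeticFlags X), Ω.IsHyperbolicCurveOrigin X →
        Ω.IsStructuresOrigin SX → Ω.IsKummerOrigin kX → Ω.IsFlagsOrigin aX →
        SX.HasStableReduction → aX.IsIsogenousToGenusZero →
          Ω.IsUnitwiseAbsolute kX ∧
            ∀ x : X.Pt, X.IsCusp x → X.IsRationalPt x → Ω.IsIntegrallyAbsoluteCusp SX x) := by
  obtain ⟨X, -, -, hcpt, hbij, ⟨x₀⟩, hsubs, hcusp, hrat, hD, hI, -, hspl⟩ :=
    TemperedCurve.exists_puncturedDisc p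
  haveI := hcpt
  haveI := hsubs
  haveI : T2Space X.PiHat := X.isProfiniteCompletion_toHat.t2Space
  obtain ⟨e, he⟩ := X.exists_continuousMulEquiv_eq_toHat
  let U : AddSubgroup ℤ := AddSubgroup.zmultiples (2 : ℤ)
  let Ω : AbsolutenessOrigin p :=
    { IsHyperbolicCurveOrigin := fun Y => Y = X
      IsDomHomOrigin := fun _ => False
      IsDLocOrigin := fun _ => False
      IsFlagsOrigin := fun _ => True
      IsStructuresOrigin := fun {Y} SY =>
        ∀ y, SY.canonicalDiscrete y = {T | Y.IsSplittingSubgroup y T} ∧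
          SY.canonicalIntegral y = {T | Y.IsSplittingSubgroup y T}
      IsKummerOrigin := fun {Y} kY => ∃ φ : kY.H1 ≃+ ℤ, kY.unitImage.map φ.toAddMonoidHom = U
      IsKummerTransportOrigin := fun _ => True
      IsCyclotomeOrigin := fun _ => False }
  let S : CuspidalStructures X :=
    { HasStableReduction := True
      canonicalIntegral := fun x => {T | X.IsSplittingSubgroup x T}
      canonicalDiscrete := fun x => {T | X.IsSplittingSubgroup x T}
      canonicalIntegral_subset := fun _ => subset_rfl
      isSplitting_of_mem := fun _ _ _ _ hT => hT
      canonicalDiscrete_nonempty := fun x _ _ => hspl x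
      canonicalIntegral_nonempty := fun _ x _ _ => hspl x }
  let k : KummerUnitData X := { H1 := ℤ, unitImage := U }
  let a : TemperedCurve.CurveArithmeticFlags X :=
    { IsOncePuncturedElliptic := False
      IsTorsionPt := fun _ => False
      IsIsogenousToGenusZero := True
      IsAlgebraicPt := fun _ => False
      IsDefinedOverNumberField := False }
  have hU : U ≠ ⊤ := by
    intro h
    have h1 : (1 : ℤ) ∈ U := h ▸ AddSubgroup.mem_top _
    obtain ⟨n, hn⟩ := AddSubgroup.mem_zmultiples_iff.1 h1
    rw [zsmul_eq_mul] at hn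
    omega
  -- RIGIDITY: any transport between certified Kummer data carries the unit image onto the unit image
  have hrigidK : ∀ {Y Y' : TemperedCurve p} (kY : KummerUnitData Y) (kY' : KummerUnitData Y'),
      Ω.IsKummerOrigin kY → Ω.IsKummerOrigin kY' → ∀ f : kY.H1 ≃+ kY'.H1,
        kY.unitImage.map f.toAddMonoidHom = kY'.unitImage := by
    rintro Y Y' kY kY' ⟨φ, hφ⟩ ⟨φ', hφ'⟩ f
    have hback : ∀ {Z : TemperedCurve p} (kZ : KummerUnitData Z) (χ : kZ.H1 ≃+ ℤ),
        kZ.unitImage.map χ.toAddMonoidHom = U → kZ.unitImage = U.map χ.symm.toAddMonoidHom := by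
      intro Z kZ χ hχ
      rw [← hχ, AddSubgroup.map_map]
      have hc : χ.symm.toAddMonoidHom.comp χ.toAddMonoidHom = AddMonoidHom.id _ :=
        AddMonoidHom.ext fun x => χ.symm_apply_apply x
      rw [hc, AddSubgroup.map_id]
    have hcomp : f.toAddMonoidHom.comp φ.symm.toAddMonoidHom =
        φ'.symm.toAddMonoidHom.comp (φ.symm.trans (f.trans φ')).toAddMonoidHom := by
      ext
      simp
    rw [hback kY φ hφ, hback kY' φ' hφ', AddSubgroup.map_map, hcomp, ← AddSubgroup.map_map,
      addSubgroup_map_int_addEquiv_leaf (φ.symm.trans (f.trans φ')) U]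
  -- the all-splittings structure = centre-splittings of `Π^temp`; `hatOf` of it = centre-splittings of `Π̂`
  have hspl' : ∀ x, {T | X.IsSplittingSubgroup x T} =
      {T : Subgroup X.PiTemp | IsClosed (T : Set X.PiTemp) ∧ T ⊓ Subgroup.center X.PiTemp = ⊥ ∧
        T ⊔ Subgroup.center X.PiTemp = ⊤} := fun x => X.setOf_isSplittingSubgroup_of_disc (hD x) (hI x)
  have hhat : ∀ x, X.hatOf {T | X.IsSplittingSubgroup x T} =
      {T : Subgroup X.PiHat | IsClosed (T : Set X.PiHat) ∧ T ⊓ Subgroup.center X.PiHat = ⊥ ∧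
        T ⊔ Subgroup.center X.PiHat = ⊤} := fun x => X.hatOf_splittings_of_disc e he (hD x) (hI x)
  -- the ten leaves
  have h66 : Ω.toTemperedOrigin.ProfiniteOuterIsoLiftsHolds := by
    rintro Y Y' (rfl : Y = X) (rfl : Y' = Y)
    exact TemperedCurve.profiniteOuterIsoLifts_of_compactSpace _ _
  have h65 : Ω.toTemperedOrigin.CuspidalAbsolutenessHolds := by
    rintro Y Y' (rfl : Y = X) (rfl : Y' = Y)
    exact TemperedCurve.isoPreservesCuspidalDecomp_of_disc _ _ (fun x _ => ⟨hD x, hI x⟩) (hcusp x₀)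
      (hD x₀) (hI x₀)
  have h13iL : ∀ Y : TemperedCurve p, Ω.IsHyperbolicCurveOrigin Y → ∀ x x' : Y.Pt,
      (∃ γ : ConjAct Y.PiHat,
        (Y.decomp x').map Y.toHat.toMonoidHom = γ • (Y.decomp x).map Y.toHat.toMonoidHom) → x' = x := by
    rintro Y (rfl : Y = X) x x' _
    exact Subsingleton.elim _ _
  have h13iiL : ∀ Y : TemperedCurve p, Ω.IsHyperbolicCurveOrigin Y → ∀ x : Y.Pt,
      Subgroup.Commensurable.commensurator ((Y.decomp x).map Y.toHat.toMonoidHom) =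
        (Y.decomp x).map Y.toHat.toMonoidHom := by
    rintro Y (rfl : Y = X) x
    have htop : (Y.decomp x).map Y.toHat.toMonoidHom = ⊤ := by
      rw [hD x, ← MonoidHom.range_eq_map]
      exact MonoidHom.range_eq_top.mpr hbij.2
    rw [htop]
    exact TemperedCurve.commensurator_top
  have hDcL : ∀ Y : TemperedCurve p, Ω.IsHyperbolicCurveOrigin Y → ∀ y : Y.Pt,
      IsCompact (Y.decomp y : Set Y.PiTemp) := by
    rintro Y (rfl : Y = X) y
    rw [hD y, Subgroup.coe_top]
    exact isCompact_univ
  have hgood : ∀ (X : TemperedCurve p) (kX : KummerUnitData X), Ω.IsHyperbolicCurveOrigin X →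
      Ω.IsKummerOrigin kX → ∀ (Y : TemperedCurve p) (kY : KummerUnitData Y) (t : KummerTransport kX kY),
      Ω.IsHyperbolicCurveOrigin Y → Ω.IsKummerOrigin kY → Ω.IsKummerTransportOrigin t →
      ∀ (αhat : X.PiHat ≃ₜ* Y.PiHat) (β : X.PiTemp ≃ₜ* Y.PiTemp), TemperedCurve.LiesUnder X Y αhat β →
        (kX.unitImage).map (t.h1OfHat αhat).toAddMonoidHom =
          (kX.unitImage).map (t.h1OfTemp β).toAddMonoidHom := by
    intro Y kY _ hkY Y' kY' t _ hkY' _ αhat β _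
    rw [hrigidK kY kY' hkY hkY' (t.h1OfHat αhat), hrigidK kY kY' hkY hkY' (t.h1OfTemp β)]
  have hsubL : ∀ (Y : TemperedCurve p) (SY : CuspidalStructures Y), Ω.IsHyperbolicCurveOrigin Y →
      Ω.IsStructuresOrigin SY → ∀ y : Y.Pt, Y.IsCusp y → ∀ T ∈ SY.canonicalDiscrete y,
        IsClosed (T : Set Y.PiTemp) ∧ T ≤ Y.decomp y := by
    rintro Y SY (rfl : Y = X) hSY y _ T hT
    rw [(hSY y).1] at hT
    exact ⟨hT.1, hT.2.1⟩
  have hstabSpl : ∀ (y : X.Pt) (t : X.PiTemp), ∀ T ∈ {T | X.IsSplittingSubgroup y T},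
      ConjAct.toConjAct t • T ∈ {T | X.IsSplittingSubgroup y T} := by
    intro y t T hT
    rw [hspl'] at hT ⊢
    rw [← image_conjAct_smul_centerSplittings_eq (ConjAct.toConjAct t)]
    exact Set.mem_image_of_mem _ hT
  have hstabL : ∀ (Y : TemperedCurve p) (SY : CuspidalStructures Y), Ω.IsHyperbolicCurveOrigin Y →
      Ω.IsStructuresOrigin SY → ∀ y : Y.Pt, Y.IsCusp y → ∀ t ∈ Y.decomp y,
        (∀ T ∈ SY.canonicalDiscrete y, ConjAct.toConjAct t • T ∈ SY.canonicalDiscrete y) ∧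
          ∀ T ∈ SY.canonicalIntegral y, ConjAct.toConjAct t • T ∈ SY.canonicalIntegral y := by
    rintro Y SY (rfl : Y = X) hSY y _ t -
    refine ⟨fun T hT => ?_, fun T hT => ?_⟩
    · rw [(hSY y).1] at hT ⊢
      exact hstabSpl y t T hT
    · rw [(hSY y).2] at hT ⊢
      exact hstabSpl y t T hT
  have hCor411 : ∀ (X : TemperedCurve p) (SX : CuspidalStructures X) (kX : KummerUnitData X)
      (aX : TemperedCurve.CurveArithmeticFlags X), Ω.IsHyperbolicCurveOrigin X →
      Ω.IsStructuresOrigin SX → Ω.IsKummerOrigin kX → Ω.IsFlagsOrigin aX →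
      SX.HasStableReduction → aX.IsIsogenousToGenusZero →
        Ω.IsUnitwiseAbsolute kX ∧
          ∀ x : X.Pt, X.IsCusp x → X.IsRationalPt x → Ω.IsIntegrallyAbsoluteCusp SX x := by
    rintro Y SY kY aY (rfl : Y = X) hSY hkY _ _ _
    refine ⟨fun Y' kY' t _ hkY' _ αhat => hrigidK kY kY' hkY hkY' (t.h1OfHat αhat), ?_⟩
    rintro x - - Y' SY' (rfl : Y' = Y) hSY' αhat y γhat - -
    rw [(hSY x).2, (hSY' y).2, hhat x, hhat y, image_map_centerSplittings_eq αhat,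
      image_conjAct_smul_centerSplittings_eq γhat]
  refine ⟨Ω, X, S, k, a, rfl, fun x => ⟨rfl, rfl⟩, ⟨AddEquiv.refl ℤ, ?_⟩, trivial,
    ⟨x₀, hcusp x₀, hrat x₀⟩, trivial, fun x => hspl x, hU, fun _ _ _ => trivial,
    h66, h65, h13iL, h13iiL, hDcL, hgood, hsubL, hstabL, hCor411⟩
  change U.map (AddEquiv.refl ℤ).toAddMonoidHom = U
  exact addSubgroup_map_int_addEquiv_leaf _ U

end AbsolutenessOrigin

end Literature.AnabelianGeometry.SemiGraphs

end
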